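import Summits.NavierStokesRegularity.NavierStokesRegularity.Theses.RellichScar
import Summits.NavierStokesRegularity.NavierStokesRegularity.Theorems.ScarRigidity.Negative.LogicAndLoadBearing
import Literature.Analysis.FluidPDE.TypeIAncientMild
import Literature.Analysis.FluidPDE.ParasiticSlabFlow
import Literature.Analysis.FluidPDE.WholeSpaceIBPIntegrable
import Literature.Analysis.FluidPDE.PressureDeterminedUpToTime
import HarnessLib

/-!
# `ScarRigidity` — line `finite-energy-log-convexity`, stub `stub_logConvexityBelowThreshold`:
# Green's first identity on the whole space under `L¹` hypotheses (crux stmt-NavierStokesRegularity-11717)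

Helper file 5 of S4 (`stub_logConvexityBelowThreshold`). The energy identities of the
Agmon–Nirenberg frame for the difference `w` of two apex profiles (`∫ ⟪Δw, w⟫ = -‖∇w‖²₂`,
`∫ ⟪∇w, ∇ψ⟫ = ‖w‖²₂`, `‖∇ψ‖²₂ = ∫ ⟪w, ψ⟫` for `ψ = (-Δ)⁻¹w`) are whole-space integrations by parts
for fields which are **not** compactly supported but decay (`|w| ≲ ρ⁻³`, `|∇w| ≲ ρ⁻²`,
`|ψ| ≲ ρ^{-1/2}`, …). This file removes the compact-support hypothesis from the tree's Green identity
`integral_inner_laplacian_add_eq_zero` (`WholeSpaceIBP`), replacing it by the integrability of the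
three families of products that occur:

* `integral_fderiv_apply_eq_zero_of_integrable` — `∫ ∂ᵥH = 0` for `H ∈ C¹` with `H, ∂ᵥH ∈ L¹`
  (the divergence theorem `integral_divergence_eq_zero_of_integrable` for the field `H • v`, whose
  divergence is `∂ᵥH`, `divergence_smul_const_eq_fderiv_apply` of `PressureDeterminedUpToTime`);
* `integral_inner_laplacian_add_eq_zero_of_integrable` — **`∫ ⟪Δv, w⟫ + Σᵢ ∫ ⟪∂ᵢv, ∂ᵢw⟫ = 0`**
  for `v ∈ C²`, `w ∈ C¹` with `⟪∂ᵢv, w⟫`, `⟪∂ᵢv, ∂ᵢw⟫`, `⟪∂ᵢ∂ᵢv, w⟫ ∈ L¹` (Leray 1934 §6 (1.11);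
  Evans, *PDE*, App. C.2 Thm. 3 with empty boundary);
* `integral_inner_laplacian_self_eq_neg` — the case `v = w`: `∫ ⟪Δw, w⟫ = -Σᵢ ∫ ‖∂ᵢw‖²`.
-/

noncomputable section

open Set Filter Function MeasureTheory Metric TopologicalSpace
open scoped Topology ENNReal NNReal InnerProductSpace RealInnerProductSpace Laplacian
open Literature.Analysis.FluidPDE
open Summit.NavierStokesRegularity.NavierStokesRegularity.Theses.RellichScar
open Summit.NavierStokesRegularity.NavierStokesRegularity.Theorems.ScarRigidity.Negative

set_option linter.dupNamespace false

namespace Summit.NavierStokesRegularity.NavierStokesRegularity.Theorems.RellichScarScarRigidity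

variable {E : Type*} [NormedAddCommGroup E] [InnerProductSpace ℝ E] [FiniteDimensional ℝ E]
  [MeasurableSpace E] [BorelSpace E]
variable {F' : Type*} [NormedAddCommGroup F'] [InnerProductSpace ℝ F']

/-! ## No boundary terms for integrable derivatives -/

/-- **No boundary terms on the whole space, `L¹` form**: `∫ ∂ᵥH = 0` for `H ∈ C¹(E; ℝ)` with
`H ∈ L¹` and `∂ᵥH ∈ L¹` (the divergence theorem `integral_divergence_eq_zero_of_integrable` for
`H • v`; Leray 1934, §6 (1.11); Evans, *PDE*, App. C.2). [cite: Leray1934, §6 (1.11) p. 203] -/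
theorem integral_fderiv_apply_eq_zero_of_integrable {H : E → ℝ} (hH : ContDiff ℝ 1 H) (v : E)
    (hint : Integrable H) (hd : Integrable fun x => fderiv ℝ H x v) :
    ∫ x, fderiv ℝ H x v = 0 := by
  have hdiv : ∀ x, VectorCalculus.divergence (fun y => H y • v) x = fderiv ℝ H x v := fun x =>
    divergence_smul_const_eq_fderiv_apply (hH.differentiable one_ne_zero x) v
  have h := integral_divergence_eq_zero_of_integrable (w := fun y => H y • v)
    (hH.smul contDiff_const) (hint.smul_const v) (by simp_rw [hdiv]; exact hd)
  simp_rw [hdiv] at h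
  exact h

/-! ## Green's first identity under `L¹` hypotheses -/

/-- **Green's first identity without boundary, `L¹` form.** For `v ∈ C²(E; F')`, `w ∈ C¹(E; F')`
and an orthonormal basis `b`, if `⟪∂ᵢv, w⟫`, `⟪∂ᵢv, ∂ᵢw⟫` and `⟪∂ᵢ∂ᵢv, w⟫` are integrable for every
`i`, then `∫ ⟪Δv, w⟫ + Σᵢ ∫ ⟪∂ᵢv, ∂ᵢw⟫ = 0` (`∂ᵢ⟪∂ᵢv, w⟫ = ⟪∂ᵢv, ∂ᵢw⟫ + ⟪∂ᵢ∂ᵢv, w⟫`, summed and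
integrated; Leray 1934 §6 (1.11), Evans App. C.2 Thm. 3). [cite: Leray1934, §6 (1.11) p. 203] -/
theorem integral_inner_laplacian_add_eq_zero_of_integrable {ι : Type*} [Fintype ι]
    (b : OrthonormalBasis ι ℝ E) {v w : E → F'} (hv : ContDiff ℝ 2 v) (hw : ContDiff ℝ 1 w)
    (hH : ∀ i, Integrable fun x => ⟪fderiv ℝ v x (b i), w x⟫)
    (hi₁ : ∀ i, Integrable fun x => ⟪fderiv ℝ v x (b i), fderiv ℝ w x (b i)⟫)
    (hi₂ : ∀ i, Integrable fun x => ⟪fderiv ℝ (fun y => fderiv ℝ v y (b i)) x (b i), w x⟫) :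
    (∫ x, ⟪(Δ v) x, w x⟫) + ∑ i, ∫ x, ⟪fderiv ℝ v x (b i), fderiv ℝ w x (b i)⟫ = 0 := by
  have hdv : ∀ i, ContDiff ℝ 1 fun y => fderiv ℝ v y (b i) := fun i =>
    (hv.fderiv_right (m := 1) le_rfl).clm_apply contDiff_const
  -- the scalar functions `Hᵢ = ⟪∂ᵢ v, w⟫`
  set H : ι → E → ℝ := fun i x => ⟪fderiv ℝ v x (b i), w x⟫ with hHdef
  have hHc : ∀ i, ContDiff ℝ 1 (H i) := fun i => (hdv i).inner ℝ hw
  have hHd : ∀ i x, fderiv ℝ (H i) x (b i) =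
      ⟪fderiv ℝ v x (b i), fderiv ℝ w x (b i)⟫ +
        ⟪fderiv ℝ (fun y => fderiv ℝ v y (b i)) x (b i), w x⟫ := fun i x => by
    rw [hHdef, fderiv_inner_apply ℝ ((hdv i).differentiable one_ne_zero x)
      (hw.differentiable one_ne_zero x)]
  -- sum the identities `∫ ∂ᵢ Hᵢ = 0`
  have hsum : ∑ i, ((∫ x, ⟪fderiv ℝ v x (b i), fderiv ℝ w x (b i)⟫) +
      ∫ x, ⟪fderiv ℝ (fun y => fderiv ℝ v y (b i)) x (b i), w x⟫) = 0 := by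
    refine Finset.sum_eq_zero fun i _ => ?_
    have hdi : Integrable fun x => fderiv ℝ (H i) x (b i) := by
      simp_rw [hHd]; exact (hi₁ i).add (hi₂ i)
    rw [← integral_add (hi₁ i) (hi₂ i),
      ← integral_fderiv_apply_eq_zero_of_integrable (hHc i) (b i) (hH i) hdi]
    exact integral_congr_ae (Eventually.of_forall fun x => (hHd i x).symm)
  rw [Finset.sum_add_distrib, ← integral_finsetSum _ fun i _ => hi₂ i] at hsum
  have hlap : ∀ x, ∑ i, ⟪fderiv ℝ (fun y => fderiv ℝ v y (b i)) x (b i), w x⟫ =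
      ⟪(Δ v) x, w x⟫ := fun x => by
    rw [← sum_inner, laplacian_eq_sum_fderiv_fderiv b hv x]
  simp_rw [hlap] at hsum
  linarith

/-- **`∫ ⟪Δw, w⟫ = -Σᵢ ∫ ‖∂ᵢw‖²`** for `w ∈ C²` with `⟪∂ᵢw, w⟫`, `‖∂ᵢw‖²`, `⟪∂ᵢ∂ᵢw, w⟫ ∈ L¹`:
the dissipation identity `⟨Aw, w⟩ = ‖A^{1/2}w‖²` of the frame in `L²`. [folklore] -/
theorem integral_inner_laplacian_self_eq_neg {ι : Type*} [Fintype ι] (b : OrthonormalBasis ι ℝ E)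
    {w : E → F'} (hw : ContDiff ℝ 2 w)
    (hH : ∀ i, Integrable fun x => ⟪fderiv ℝ w x (b i), w x⟫)
    (hi₁ : ∀ i, Integrable fun x => ‖fderiv ℝ w x (b i)‖ ^ 2)
    (hi₂ : ∀ i, Integrable fun x => ⟪fderiv ℝ (fun y => fderiv ℝ w y (b i)) x (b i), w x⟫) :
    ∫ x, ⟪(Δ w) x, w x⟫ = -∑ i, ∫ x, ‖fderiv ℝ w x (b i)‖ ^ 2 := by
  have hi₁' : ∀ i, Integrable fun x => ⟪fderiv ℝ w x (b i), fderiv ℝ w x (b i)⟫ := fun i => by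
    simp_rw [real_inner_self_eq_norm_sq]; exact hi₁ i
  have h := integral_inner_laplacian_add_eq_zero_of_integrable b hw (hw.of_le one_le_two) hH hi₁' hi₂
  simp_rw [real_inner_self_eq_norm_sq] at h
  linarith

/-! ## Registered sub-goal (helper stub of `stub_logConvexityBelowThreshold`) -/

/-- **Registered helper stub `stub_greenIdentityL1`** (crux stmt-NavierStokesRegularity-11717, line
`finite-energy-log-convexity`, helper of S4): Green's first identity on `ℝ³` under `L¹` hypotheses,
in the standard basis, as registered. [folklore] -/
theorem stub_greenIdentityL1 :
    ∀ (v w : EuclideanSpace ℝ (Fin 3) → EuclideanSpace ℝ (Fin 3)), ContDiff ℝ 2 v → ContDiff ℝ 1 w →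
      (∀ i : Fin 3, Integrable (fun x => ⟪fderiv ℝ v x (EuclideanSpace.basisFun (Fin 3) ℝ i), w x⟫)
        volume) →
      (∀ i : Fin 3, Integrable (fun x => ⟪fderiv ℝ v x (EuclideanSpace.basisFun (Fin 3) ℝ i),
        fderiv ℝ w x (EuclideanSpace.basisFun (Fin 3) ℝ i)⟫) volume) →
      (∀ i : Fin 3, Integrable (fun x =>
        ⟪fderiv ℝ (fun y => fderiv ℝ v y (EuclideanSpace.basisFun (Fin 3) ℝ i)) x
          (EuclideanSpace.basisFun (Fin 3) ℝ i), w x⟫) volume) →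
      (∫ x, ⟪Laplacian.laplacian v x, w x⟫) +
        ∑ i : Fin 3, ∫ x, ⟪fderiv ℝ v x (EuclideanSpace.basisFun (Fin 3) ℝ i),
          fderiv ℝ w x (EuclideanSpace.basisFun (Fin 3) ℝ i)⟫ = 0 :=
  fun _v _w hv hw hH hi₁ hi₂ =>
    integral_inner_laplacian_add_eq_zero_of_integrable (EuclideanSpace.basisFun (Fin 3) ℝ) hv hw hH
      hi₁ hi₂

end Summit.NavierStokesRegularity.NavierStokesRegularity.Theorems.RellichScarScarRigidity

end
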